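import Summits.AtomisticToContinuum.HydrodynamicLimit.Theorems.OddContactSymmetry.Negative.VelocityHoleWeight

/-!
# Negative knowledge for crux `JParityClosure.OddContactSymmetry` (stmt-AtomisticToContinuum-13078):
# the velocity hole is a property of the `r`-BALL cloud — and shell-supported marks do not bound the weight

Standing disprover `refuter-cdisprove-stmt-AtomisticToContinuum-13078-g2-0` (gen 2, 2026-08-16), companion of
`Cruxes/OddContactSymmetry/Disproof.lean` §8; sharpens lead-0's `VelocityHoleWeight.lean`.

* `hMoll_le_of_isolated_inBall` — the hole lemma with the RIGHT hypothesis: the `(r,ϑ)`-mollified empirical law at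
  `(x₀, u)` is `≤ ρm(x₀)(2πϑ²)^{−3/2}e^{−d²/2ϑ²}` as soon as `u` is at distance `≥ d` from the current velocities of the
  particles INSIDE the open `r`-ball around `x₀` only (the cone kernel kills the others).  `VelocityHoleWeight.hMoll_le_of_isolated`
  asks isolation from ALL `N + 1` velocities, which is too weak to express the equilibrium blow-up (far-away particles do have
  velocities near the deep pre-velocity; the `≍ r³N` ball particles do not) — this version is the one the extreme-value
  bookkeeping of Disproof §7 / BlowupAnalysis.md actually uses.
* `exp_neg_surprisal_ge_rhoMoll_inBall` — the one-contact weight bound `e^{−F} ≥ (3/πr³)²(1−ε/r)/((N+1)²ρm²)·e^{(d₁²+d₂²)/2ϑ²}`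
  under ball-isolation of the two pre-collisional queries.
* `rhoMoll_le_of_depleted`, `depletedBall_weight_ge` — **spatial holes**: if the colliding pair is ALONE in its `r`-ball, then
  `ρm ≤ 2·3/(πr³(N+1))` and the weight is at least `(1−ε/r)/4 · e^{(d₁²+d₂²)/2ϑ²}`, INDEPENDENTLY OF `N`, where now `d₁, d₂` are
  just the distances of the pre-collisional velocities from the two post-collisional ones — for `(v⁻,w⁻) = reflectVel n̂ (vᵢ,vⱼ)`
  these are `min(|⟨g,n̂⟩|, |g_⊥|)`-type THERMAL quantities (`g = vᵢ − vⱼ`).  So for the repair C′₁ (marks supported in an energy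
  shell `‖v‖²+‖w‖² < R`, weight `1 + e^{−F}` kept) the weight is still UNBOUNDED over configurations with all four queries on the
  shell: e.g. `|⟨g,n̂⟩| = |g_⊥| = 1`, `ϑ = 0.05` gives `e^{−F} ≥ 0.2·e^{400}`.  C′₁'s tightness is therefore NOT deterministic but an
  OCCUPATION statement ("no contributing collision ever happens in a depleted / velocity-depleted `r`-ball", probability
  `≈ N^{4/3}e^{−c r³ϑ³e^{−R/2θ}N} → 0` at rung 0 but needed uniformly over all collision instants), whereas the sub-unit
  parity-exact weights of `ParityExactWeights.lean` (C′₃ Metropolis, Barker, C″ cutoffs) are bounded by fiat.  This is the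
  kernel-checked form of the "KDE-floor debt" of C′₁ recorded by leads r-1 / a1-0 in PICKED.md.
-/

noncomputable section

open scoped InnerProductSpace BigOperators
open MeasureTheory

namespace Summit.AtomisticToContinuum.HydrodynamicLimit.Theorems

namespace OddContactSymmetryNegative

open Literature.Analysis.FluidPDE Literature.MathematicalPhysics.KineticTheory

variable {N : ℕ}

/-- The cone kernel vanishes outside the open `r`-ball (`r > 0`). [folklore] -/
theorem coneKernel_eq_zero_of_le_dist {r : ℝ} (hr : 0 < r) {x y : T3} (h : r ≤ Torus.euclidDist x y) :
    3 / (Real.pi * r ^ 3) * max (1 - Torus.euclidDist x y / r) 0 = 0 := by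
  have h1 : 1 - Torus.euclidDist x y / r ≤ 0 := by
    rw [sub_nonpos, le_div_iff₀ hr, one_mul]
    exact h
  rw [max_eq_right h1, mul_zero]

/-- **The velocity hole, ball version.**  If the query velocity `u` is at distance at least `d ≥ 0` from the current
velocity of every particle INSIDE the open `r`-ball around `x₀`, then `hm(x₀, u) ≤ ρm(x₀) · (2πϑ²)^{−3/2} e^{−d²/2ϑ²}`
(particles outside the ball carry cone weight `0` and impose nothing). [folklore] -/
theorem hMoll_le_of_isolated_inBall (w : Config (N + 1) (Fin 3) T3) {r ϑ d : ℝ} (hr : 0 < r) (hϑ : 0 < ϑ)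
    (hd : 0 ≤ d) (x₀ : T3) {u : V3}
    (hiso : ∀ k, Torus.euclidDist (w k).1 x₀ < r → d ≤ ‖u - (w k).2‖) :
    ∫ q, 3 / (Real.pi * r ^ 3) * max (1 - Torus.euclidDist q.1 x₀ / r) 0 *
        localMaxwellian 1 (ϑ ^ 2) u q.2 ∂(empiricalMeasure w) ≤
      (∫ q, 3 / (Real.pi * r ^ 3) * max (1 - Torus.euclidDist q.1 x₀ / r) 0 ∂(empiricalMeasure w)) *
        ((2 * Real.pi * ϑ ^ 2) ^ (-(Module.finrank ℝ V3 : ℝ) / 2) * Real.exp (-d ^ 2 / (2 * ϑ ^ 2))) := by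
  rw [hMoll_eq_sum, rhoMoll_eq_sum, mul_assoc, Finset.sum_mul]
  refine mul_le_mul_of_nonneg_left (Finset.sum_le_sum fun k _ => ?_) (by positivity)
  have hϑ2 : 0 < ϑ ^ 2 := by positivity
  by_cases hk : Torus.euclidDist (w k).1 x₀ < r
  · refine mul_le_mul_of_nonneg_left ?_ (coneKernel_nonneg_le hr (w k).1 x₀).1
    have h' : d ≤ ‖(w k).2 - u‖ := by rw [norm_sub_rev]; exact hiso k hk
    exact localMaxwellian_one_le_of_le_norm_sub hϑ2 hd h'
  · rw [coneKernel_eq_zero_of_le_dist hr (not_lt.1 hk), zero_mul, zero_mul]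

/-- **One-contact weight bound under ball-isolation.**  For a configuration `w`, an ordered pair `(i, j)` with
`dist(xⱼ, xᵢ) ≤ ε ≤ r`, and two query velocities `v⁻, w⁻` (the pre-collisional pair) at distance `≥ d₁`, resp. `≥ d₂`, from
the current velocity of every particle inside the open `r`-ball around `xᵢ`:
`e^{−F} ≥ (3/πr³)² (1 − ε/r) / ((N+1)² ρm(xᵢ)²) · exp((d₁² + d₂²)/2ϑ²)`. [folklore] -/
theorem exp_neg_surprisal_ge_rhoMoll_inBall (w : Config (N + 1) (Fin 3) T3) {r ϑ ε d₁ d₂ : ℝ}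
    (hr : 0 < r) (hϑ : 0 < ϑ) (hεr : ε ≤ r) (hd₁ : 0 ≤ d₁) (hd₂ : 0 ≤ d₂)
    {i j : Fin (N + 1)} (hdist : Torus.euclidDist (w j).1 (w i).1 ≤ ε) (vm wm : V3)
    (hvm : ∀ k, Torus.euclidDist (w k).1 (w i).1 < r → d₁ ≤ ‖vm - (w k).2‖)
    (hwm : ∀ k, Torus.euclidDist (w k).1 (w i).1 < r → d₂ ≤ ‖wm - (w k).2‖) :
    let ρm : ℝ := ∫ q, 3 / (Real.pi * r ^ 3) * max (1 - Torus.euclidDist q.1 (w i).1 / r) 0 ∂(empiricalMeasure w)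
    let hm : V3 → ℝ := fun u => ∫ q, 3 / (Real.pi * r ^ 3) * max (1 - Torus.euclidDist q.1 (w i).1 / r) 0 *
      localMaxwellian 1 (ϑ ^ 2) u q.2 ∂(empiricalMeasure w)
    (3 / (Real.pi * r ^ 3)) ^ 2 * (1 - ε / r) / (((N : ℝ) + 1) ^ 2 * ρm ^ 2) *
        Real.exp ((d₁ ^ 2 + d₂ ^ 2) / (2 * ϑ ^ 2)) ≤
      Real.exp (-(Real.log (hm vm) + Real.log (hm wm) - Real.log (hm (w i).2) - Real.log (hm (w j).2))) := by
  intro ρm hm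
  have ha : 0 < hm vm := hMoll_pos w hr hϑ i vm
  have hb : 0 < hm wm := hMoll_pos w hr hϑ i wm
  have hc : 0 < hm (w i).2 := hMoll_pos w hr hϑ i (w i).2
  have hd : 0 < hm (w j).2 := hMoll_pos w hr hϑ i (w j).2
  have hρ : 0 < ρm := lt_of_lt_of_le (by positivity) (rhoMoll_self_ge w hr i)
  set n : ℝ := (N : ℝ) + 1 with hn_def
  have hn : 0 < n := by positivity
  set b₀ : ℝ := 3 / (Real.pi * r ^ 3) with hb₀_def
  have hb₀ : 0 < b₀ := by positivity
  set c : ℝ := (2 * Real.pi * ϑ ^ 2) ^ (-(Module.finrank ℝ V3 : ℝ) / 2) with hc_def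
  have hcpos : 0 < c := Real.rpow_pos_of_pos (by positivity) _
  set e₁ : ℝ := Real.exp (-d₁ ^ 2 / (2 * ϑ ^ 2)) with he₁_def
  set e₂ : ℝ := Real.exp (-d₂ ^ 2 / (2 * ϑ ^ 2)) with he₂_def
  set E : ℝ := Real.exp ((d₁ ^ 2 + d₂ ^ 2) / (2 * ϑ ^ 2)) with hE_def
  have hεr' : 0 ≤ 1 - ε / r := by
    rw [sub_nonneg, div_le_one hr]
    exact hεr
  have h1 : n⁻¹ * (b₀ * c) ≤ hm (w i).2 := hMoll_self_ge w hr hϑ i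
  have h2 : n⁻¹ * (b₀ * (1 - ε / r) * c) ≤ hm (w j).2 := hMoll_partner_ge w hr hϑ hdist
  have h3 : hm vm ≤ ρm * (c * e₁) := hMoll_le_of_isolated_inBall w hr hϑ hd₁ (w i).1 hvm
  have h4 : hm wm ≤ ρm * (c * e₂) := hMoll_le_of_isolated_inBall w hr hϑ hd₂ (w i).1 hwm
  have hEe : E * (e₁ * e₂) = 1 := by
    rw [hE_def, he₁_def, he₂_def, ← Real.exp_add, ← Real.exp_add]
    convert Real.exp_zero using 2
    ring
  have hexp : Real.exp (-(Real.log (hm vm) + Real.log (hm wm) - Real.log (hm (w i).2) - Real.log (hm (w j).2))) =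
      hm (w i).2 * hm (w j).2 / (hm vm * hm wm) := by
    rw [show -(Real.log (hm vm) + Real.log (hm wm) - Real.log (hm (w i).2) - Real.log (hm (w j).2)) =
        (Real.log (hm (w i).2) + Real.log (hm (w j).2)) - (Real.log (hm vm) + Real.log (hm wm)) by ring,
      Real.exp_sub, Real.exp_add, Real.exp_add, Real.exp_log ha, Real.exp_log hb, Real.exp_log hc,
      Real.exp_log hd]
  rw [hexp, le_div_iff₀ (mul_pos ha hb)]
  calc b₀ ^ 2 * (1 - ε / r) / (n ^ 2 * ρm ^ 2) * E * (hm vm * hm wm)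
      ≤ b₀ ^ 2 * (1 - ε / r) / (n ^ 2 * ρm ^ 2) * E * ((ρm * (c * e₁)) * (ρm * (c * e₂))) := by
        gcongr
    _ = b₀ ^ 2 * (1 - ε / r) / (n ^ 2 * ρm ^ 2) * (ρm * c) ^ 2 * (E * (e₁ * e₂)) := by ring
    _ = (n⁻¹ * (b₀ * c)) * (n⁻¹ * (b₀ * (1 - ε / r) * c)) := by
        rw [hEe, mul_one]
        field_simp
    _ ≤ hm (w i).2 * hm (w j).2 :=
        mul_le_mul h1 h2 (by positivity) hc.le

/-! ## Spatial holes: the depleted ball -/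

/-- **Depleted ball.**  If no particle other than `i` and `j` lies in the open `r`-ball around `xᵢ`, the cone-mollified
density there is at most the two self terms: `ρm(xᵢ) ≤ 2 · 3/(π r³ (N+1))`. [folklore] -/
theorem rhoMoll_le_of_depleted (w : Config (N + 1) (Fin 3) T3) {r : ℝ} (hr : 0 < r) {i j : Fin (N + 1)}
    (hempty : ∀ k, k ≠ i → k ≠ j → r ≤ Torus.euclidDist (w k).1 (w i).1) :
    ∫ q, 3 / (Real.pi * r ^ 3) * max (1 - Torus.euclidDist q.1 (w i).1 / r) 0 ∂(empiricalMeasure w) ≤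
      ((N : ℝ) + 1)⁻¹ * (2 * (3 / (Real.pi * r ^ 3))) := by
  classical
  rw [rhoMoll_eq_sum]
  refine mul_le_mul_of_nonneg_left ?_ (by positivity)
  set f : Fin (N + 1) → ℝ := fun k => 3 / (Real.pi * r ^ 3) * max (1 - Torus.euclidDist (w k).1 (w i).1 / r) 0
    with hf_def
  have hzero : ∀ k ∈ (Finset.univ : Finset (Fin (N + 1))), k ∉ ({i, j} : Finset (Fin (N + 1))) → f k = 0 := by
    intro k _ hk
    rw [Finset.mem_insert, Finset.mem_singleton, not_or] at hk
    exact coneKernel_eq_zero_of_le_dist hr (hempty k hk.1 hk.2)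
  have hsub : ({i, j} : Finset (Fin (N + 1))) ⊆ Finset.univ := Finset.subset_univ _
  rw [← Finset.sum_subset hsub hzero]
  have hle : ∀ k ∈ ({i, j} : Finset (Fin (N + 1))), f k ≤ 3 / (Real.pi * r ^ 3) :=
    fun k _ => (coneKernel_nonneg_le hr (w k).1 (w i).1).2
  have hcard : (({i, j} : Finset (Fin (N + 1))).card : ℝ) ≤ 2 := by
    exact_mod_cast Finset.card_le_two
  have hM : 0 ≤ 3 / (Real.pi * r ^ 3) := by positivity
  calc ∑ k ∈ ({i, j} : Finset (Fin (N + 1))), f k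
      ≤ ∑ _k ∈ ({i, j} : Finset (Fin (N + 1))), 3 / (Real.pi * r ^ 3) := Finset.sum_le_sum hle
    _ = (({i, j} : Finset (Fin (N + 1))).card : ℝ) * (3 / (Real.pi * r ^ 3)) := by
        rw [Finset.sum_const, nsmul_eq_mul]
    _ ≤ 2 * (3 / (Real.pi * r ^ 3)) := mul_le_mul_of_nonneg_right hcard hM

/-- **Shell-supported marks do not bound the weight (the depleted-ball witness).**  If the colliding pair `(i, j)`
(`dist ≤ ε ≤ r`) is ALONE in the open `r`-ball around `xᵢ`, and the two query velocities `v⁻, w⁻` are at distance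
`≥ d₁`, resp. `≥ d₂`, from the two CURRENT velocities `vᵢ, vⱼ` only, then
`e^{−F} ≥ (1 − ε/r)/4 · exp((d₁² + d₂²)/2ϑ²)` — a bound that does not depend on `N` and in which nothing is fast: for
`(v⁻, w⁻) = reflectVel n̂ (vᵢ, vⱼ)` the distances are the thermal momentum transfers `|⟨g, n̂⟩|`, `‖g_⊥‖`, and all four queries
sit on one energy shell.  Hence the repair C′₁ (energy-shell support of `Ψ`, weight `1 + e^{−F}` kept) is not deterministically
tight; only an occupation estimate for `r`-balls at all contributing collision instants can make it tight, unlike the sub-unit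
parity-exact weights (`ParityExactWeights.le_min_of_parityExact_le_one`). [folklore] -/
theorem depletedBall_weight_ge (w : Config (N + 1) (Fin 3) T3) {r ϑ ε d₁ d₂ : ℝ}
    (hr : 0 < r) (hϑ : 0 < ϑ) (hεr : ε ≤ r) (hd₁ : 0 ≤ d₁) (hd₂ : 0 ≤ d₂)
    {i j : Fin (N + 1)} (hdist : Torus.euclidDist (w j).1 (w i).1 ≤ ε)
    (hempty : ∀ k, k ≠ i → k ≠ j → r ≤ Torus.euclidDist (w k).1 (w i).1) (vm wm : V3)
    (hvi : d₁ ≤ ‖vm - (w i).2‖) (hvj : d₁ ≤ ‖vm - (w j).2‖)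
    (hwi : d₂ ≤ ‖wm - (w i).2‖) (hwj : d₂ ≤ ‖wm - (w j).2‖) :
    let hm : V3 → ℝ := fun u => ∫ q, 3 / (Real.pi * r ^ 3) * max (1 - Torus.euclidDist q.1 (w i).1 / r) 0 *
      localMaxwellian 1 (ϑ ^ 2) u q.2 ∂(empiricalMeasure w)
    (1 - ε / r) / 4 * Real.exp ((d₁ ^ 2 + d₂ ^ 2) / (2 * ϑ ^ 2)) ≤
      Real.exp (-(Real.log (hm vm) + Real.log (hm wm) - Real.log (hm (w i).2) - Real.log (hm (w j).2))) := by
  intro hm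
  -- ball-isolation: inside the ball there are only `i` and `j`
  have hin : ∀ k, Torus.euclidDist (w k).1 (w i).1 < r → k = i ∨ k = j := by
    intro k hk
    by_contra hne
    rw [not_or] at hne
    exact absurd (hempty k hne.1 hne.2) (not_le.2 hk)
  have hvm : ∀ k, Torus.euclidDist (w k).1 (w i).1 < r → d₁ ≤ ‖vm - (w k).2‖ := by
    intro k hk
    rcases hin k hk with rfl | rfl
    · exact hvi
    · exact hvj
  have hwm : ∀ k, Torus.euclidDist (w k).1 (w i).1 < r → d₂ ≤ ‖wm - (w k).2‖ := by
    intro k hk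
    rcases hin k hk with rfl | rfl
    · exact hwi
    · exact hwj
  have key := exp_neg_surprisal_ge_rhoMoll_inBall w hr hϑ hεr hd₁ hd₂ hdist vm wm hvm hwm
  refine le_trans ?_ key
  -- `(1 − ε/r)/4 ≤ (3/πr³)² (1 − ε/r) / ((N+1)² ρm²)` because `0 < (N+1) ρm ≤ 2 · 3/πr³`
  have hρle := rhoMoll_le_of_depleted w hr hempty
  have hρpos : 0 < ∫ q, 3 / (Real.pi * r ^ 3) * max (1 - Torus.euclidDist q.1 (w i).1 / r) 0 ∂(empiricalMeasure w) :=
    lt_of_lt_of_le (by positivity) (rhoMoll_self_ge w hr i)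
  set ρm : ℝ := ∫ q, 3 / (Real.pi * r ^ 3) * max (1 - Torus.euclidDist q.1 (w i).1 / r) 0 ∂(empiricalMeasure w)
    with hρm_def
  have hεr' : 0 ≤ 1 - ε / r := by
    rw [sub_nonneg, div_le_one hr]
    exact hεr
  refine mul_le_mul_of_nonneg_right ?_ (Real.exp_nonneg _)
  have hn : (0 : ℝ) < (N : ℝ) + 1 := by positivity
  have hb₀ : (0 : ℝ) < 3 / (Real.pi * r ^ 3) := by positivity
  -- `(N+1) ρm ≤ 2 b₀`
  have hprod : ((N : ℝ) + 1) * ρm ≤ 2 * (3 / (Real.pi * r ^ 3)) := by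
    have := mul_le_mul_of_nonneg_left hρle hn.le
    rwa [← mul_assoc, mul_inv_cancel₀ hn.ne', one_mul] at this
  have hprod_pos : 0 < ((N : ℝ) + 1) * ρm := mul_pos hn hρpos
  have hsq : (((N : ℝ) + 1) * ρm) ^ 2 ≤ (2 * (3 / (Real.pi * r ^ 3))) ^ 2 :=
    pow_le_pow_left₀ hprod_pos.le hprod 2
  rw [div_le_div_iff₀ (by norm_num : (0 : ℝ) < 4) (by positivity)]
  calc (1 - ε / r) * (((N : ℝ) + 1) ^ 2 * ρm ^ 2) = (1 - ε / r) * (((N : ℝ) + 1) * ρm) ^ 2 := by ring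
    _ ≤ (1 - ε / r) * (2 * (3 / (Real.pi * r ^ 3))) ^ 2 := mul_le_mul_of_nonneg_left hsq hεr'
    _ = (3 / (Real.pi * r ^ 3)) ^ 2 * (1 - ε / r) * 4 := by ring

end OddContactSymmetryNegative

end Summit.AtomisticToContinuum.HydrodynamicLimit.Theorems

end
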